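import Mathlib
import HarnessLib
import HarnessLib.Audit
import Summits.HubbardSuperconductivity.Statement

/-!
Route: EomCeiling

CLOSED (retired) 2026-08-15T13:48:18Z by operator:999:1257524 — reason: not-a-thesis: assembly does not conclude the sub-problem Statement — note: D-0027 §2.1 audit (human 2026-08-15: routes that do not decide the summit are removed): the assembly concludes `NoUniformWeakCouplingOrder`, not the sub-problem statement; a NEW conforming route may be opened from the same idea (generated `closes : … → _root_.HubbardSuperconductivity`).. The file is kept as the record of this route; refuted decls are indexed as negative knowledge (`ledger negatives`).

Route EomCeiling — HubbardSuperconductivity/HubbardSuperconductivity, NEGATIVE SIDE / CALIBRATION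
(plancard; realises idea card
HubbardSuperconductivity/HubbardSuperconductivity/eom-resolvent-ceiling, novelty audit
new-combination).

THESIS X (it suffices to show, for this route's target) = EveryGSCeiling ∧ WeakCouplingStability:
 (A) EveryGSCeiling — BACH–LIEB–SOLOVEJ FOR TRUE GROUND STATES. For every finite-range singlet form
factor g there is C(g) such that for EVERY real U, every L ≥ 3, every N and EVERY normalised (N,
S^z=0)-sector ground state ψ of hubbardTorus 2 L 1 U:
     L⁻⁴ ⟨ψ, (pairField g L)†(pairField g L) ψ⟩ ≤ C·( U²(1+|log U|)⁴ + κ_L + 1/L ),   κ_L := ( E(N)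
− (E(N−2)+E(N+2))/2 )₊,  E(M) := minEnergyOn (szSector M 0):
     pair order is AT MOST SECOND ORDER in the bare coupling, in every channel, for every ground
state, with the finite-volume non-convexity κ_L of the sector energies as the only extra term — by
the Heisenberg equation of motion of the plane-wave pair mode and two sector resolvent bounds, no
expansion.
 (B) WeakCouplingStability — for every δ ∈ (0,1/2), η > 0, U₀ > 0 some U ∈ (0,U₀) has κ_L(U, N_L(δ))
< η for infinitely many even L (N_L = 2⌊(1−δ)L²/2⌋).
TARGET (negative knowledge about the summit, decl NoUniformWeakCouplingOrder): ¬( ∃ δ ∈ (0,1/2), c >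
0, U₀ > 0 such that for ALL U ∈ (0,U₀) every admissible (N_L, S^z=0)-sector ground-state sequence —
exactly the summit's hypotheses — has eventually (2k)⁻⁴ Σ_{x,y} torusPullback (pairFieldCorr
dWaveFormFactor ψ) (2k) x y ≥ c ). In words: the summit's order constant cannot be uniform as U →
0⁺; every S-witness (U, δ, c) obeys c ≤ C_d·U²(1+|log U|)⁴ up to finite-size non-convexity. This
neither proves nor refutes S at fixed U > 0 (stated plainly: a calibration route, sibling of NoGo).
ASSEMBLY (pure logic + existence of sector ground states in finite dimension; rc 0 in the planner's
Sketch.lean): EveryGSCeiling → WeakCouplingStability → NoUniformWeakCouplingOrder.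
One-line Lean form of X: `EveryGSCeiling ∧ WeakCouplingStability` (decls of this file). All nine
items elaborate (lean check rc 0) over EXISTING declarations only:
Literature.MathematicalPhysics.QuantumLattice.{hubbardTorus, IsGroundStateInSector, szSector,
pairField, pairFieldCorr, dWaveFormFactor, unitSteps, expect, annihilation, orb, numberOp, Fock,
Orb, FermionTorus, torusPullback}, Matrix.minEnergyOn, Literature.Probability.LatticeModels.{Site,
halfOpenBox}; the momentum-space objects (pair modes b_m = c_{m↑}c_{−m↓} with c_{mσ} = L⁻¹Σ_x
e^{−2πi m·x/L} c_{xσ}, dispersion ε_m = −2(cos(2πm₀/L)+cos(2πm₁/L))) are written INLINE as finite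
sums — no definition request is needed.

TWO-LAYER PLAN (D-0019). Layer 1 = ranked cruxes: (2) EveryGSCeiling [the mechanism's theorem;
provable now, rests only on proved tree facts: CAR (annihilation_anticommute_holds,
annihilation_mul_creation_add_creation_mul_annihilation_holds), sector variational principle]; (3)
WeakCouplingStability [open: finite-volume midpoint convexity of E(N) at weak coupling along
infinitely many L]; (4) BeyondSecondOrder [open sharpening: limit law C·U⁴ along even sides, implies
the target by itself]. Supports (rank 9, provable now, Lean-sized, library value regardless):
PairModeEquationOfMotion ([H, b_m] = −2ε_m b_m + U[D, b_m], L ≥ 3), SoftPauliBlockingPairs (‖b_mψ‖ ≤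
|U|/(ε_m − μ_L) for ε_m > μ_L := (E(N)−E(N−2))/2 and ‖b_m†ψ‖ ≤ |U|/(μ_L⁺ − ε_m) for ε_m < μ_L⁺ :=
(E(N+2)−E(N))/2, EVERY ground state, every U), PairFieldPlaneWaves (pairField g L = √2 Σ_m σ_g(m)
b_m, σ_g(m) = Σ_e g(e) cos(2π m·e/L); verified numerically at coefficient level for L ≤ 5 and four
form factors incl. an asymmetric one), ResolventSumBound (Σ_m min(1, U/|ε_m − μ|) ≤ C(L²U(1+|log
U|)² + L(1+log L)) UNIFORMLY in μ — the only place the band structure enters; the van Hove saddle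
costs the extra logarithms and the Θ(L log L) lattice points near level sets the L-term). Layer 2
(only after EveryGSCeiling closes): split BeyondSecondOrder (one more EOM iteration on [D, b_m] with
three-fermion symbols, or the sourced-energy descent of card probe-legendre-order-ceiling) and
WeakCouplingStability (free-gas convexity + continuity in U at fixed L versus L-uniformity);
optional supports MomentumDistributionTail (⟨n_{kσ}⟩ ≤ U²/(ε_k − μ^{(1)}_L)² from [H, c_{k↑}] = −ε_k
c_{k↑} − U F_k) and B1gTransparency ([T, Δ_d] = 2Δ_d^{(2)}) when a consumer asks (YangSpectral
overlap crux: Fermi-surface localisation of the condensate vector; GSCertificate: a-priori scale;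
NoGo: weak-coupling census).

Rationale: WHY THIS LINE (catalogue: spectral/operator reformulation + operator inequalities; no cross-field
import — deliberately: the point is that the BCS gap equation is an EXACT identity in every
eigenstate). [H, b_k] = −2ε_k b_k + U[D, b_k] for the plane-wave pair mode b_k = c_{k↑}c_{−k↓}
gives, in EVERY sector ground state, (H − E_N + 2ε_k) b_kψ = U[D,b_k]ψ in sector N−2 and (H − E_N −
2ε_k) b_k†ψ = −U[D,b_k]†ψ in sector N+2 (Gor'kov's equation, exact form); the dressing is SMALL IN
NORM (‖[D,b_k]‖ ≤ 2: [D, c_{k↑}] = −F_k, {F_k, F_k†} = N_↓/L² ≤ 1) and the neighbouring sectors are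
bounded below by E(N∓2) = E_N ∓ 2μ_L^{(∓)} (definition of minEnergyOn), so ‖b_kψ‖ ≤ |U|/(ε_k − μ_L)
above and ‖b_k†ψ‖ ≤ |U|/(μ_L⁺ − ε_k) below: the free-gas Pauli step softened to a |U|/|ξ_k| tail,
mode by mode, for every ground state at every coupling (SoftPauliBlockingPairs). Summing with the
in/out trick ⟨A†A⟩ = ⟨AA†⟩ + ⟨[A†,A]⟩ (distinct pair modes commute; the diagonal commutator is
O(L²)) and a μ-UNIFORM resolvent sum (ResolventSumBound — so the interacting chemical potentials
never need to be located) gives EveryGSCeiling: LRO_g ≤ C(U²(1+|log U|)⁴ + κ_L + 1/L) for every GS —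
BachLiebSolovej1994 Thm 2.11 ('no pairing at first order in V ≥ 0', quasi-free class) as a theorem
about TRUE ground states, the order-parameter twin of 'Kohn–Luttinger is second order'
(ArovasBergKivelsonRaghu2022 §5.1, RaghuKivelsonScalapino2010), one power of U below the in-sub
Legendre card (LRO ≤ C·U·log, unrouted) and with a shorter proof. Assembled with the finite-size
stability crux it yields a clean NEGATIVE statement in the summit's own quantifiers: no U-uniform
witness family (NoUniformWeakCouplingOrder). Honest scope: calibration — vacuous above U ≈ 0.1,
silent on S at fixed U.
RANKED CRUXES. (2) EveryGSCeiling — most informative: it IS the mechanism; provable now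
(finite-dimensional CAR algebra + one lattice-point count); kill: ED 4×4/6×6 at U = 0.5, 1, 2
violating ‖b_kψ‖ ≤ U/(ε_k − μ_L) for any mode (unconditional inequality ⇒ an algebra slip). (3)
WeakCouplingStability — open; E(N) − (E(N−2)+E(N+2))/2 → 0 is free-gas exact (κ = 0 at U = 0 for
even N: levels fill in order) and physically O(1/L²), but finite-volume convexity of interacting
sector energies is no theorem; the Assembly needs only 'small for SOME arbitrarily small U along
infinitely many even L'. (4) BeyondSecondOrder — the research bet of the line (every-GS pair order
O(U⁴), eventually O(U^∞), matching PerturbativeInvisibility from ABOVE); one more EOM iteration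
meets non-sign-definite three-body denominators, so a new idea is needed; implies the target alone.
SUPPORTS (rank 9, provable now): PairModeEquationOfMotion, SoftPauliBlockingPairs,
PairFieldPlaneWaves, ResolventSumBound (see thesis). Infrastructure lemmas (plane-wave CAR, T = Σ_k
ε_k n_{kσ} for L ≥ 3 — for L = 2 the simple torus graph halves the dispersion, hence '2 < L'
everywhere —, ⟨φ,Hφ⟩ ≥ minEnergyOn·‖φ‖² on a sector, ‖X‖² ≤ ‖X†X + XX†‖) ride with `--supports`,
never as items.
KILL CRITERIA. (i) ED counterexample to SoftPauliBlockingPairs/PairModeEquationOfMotion at any (U, L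
≥ 3, N) → algebra slip: restate once or close. (ii) A doping δ with κ_L ≥ κ₀ > 0 for all small U and
all large even L (finite-size phase separation at weak coupling) refutes WeakCouplingStability →
Assembly dead; keep EveryGSCeiling as a Literature-grade theorem, pursue the target via
BeyondSecondOrder-type limit laws or close `exhausted`. (iii) NoUniformWeakCouplingOrder refuted
(U-uniform d-wave order as U → 0⁺!) would be first-rank POSITIVE news for the summit and kills the
route happily. (iv) BeyondSecondOrder refuted at some g (order ∼ U² amplitude) → drop it; the rest
stands.
NOT DECOMPOSED (deliberately): the δ-dependent sharp law U²log²(1/U) of the card (needs the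
interacting pair chemical potential μ_L within o(1) of the free Fermi level and away from the van
Hove energy — i.e. control of E(N) − E(N−2), not cheap; the uniform U²log⁴ law filed instead needs
no such input); the one-body momentum tail and B1g transparency (no consumer yet); any positive-side
use (the linear EOM bound is too lossy by construction: its error U²log⁴ exceeds the expected signal
e^{−c/U²}); U < 0 readings for NoGo's attractive crux (the ceiling is sign-blind and already stated
for all real U).
NUMBERS. Items at open: 9 (target, assembly, 3 cruxes, 4 supports), all rc 0. ‖[D,b_k]‖ ≤ 2; |σ_d| ≤
4; free DOS ν(ε) ≈ (2π²)⁻¹ log(16/|ε|) at the van Hove level ⇒ |{|ε−μ| < b}| ≤ C b(1+log⁺(1/b))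
uniformly in μ; #{k ∈ (2π/L)ℤ²: |ε_k| ≲ 1/L} = Θ(L log L). Conventions checked numerically this
session (check_conv.py, L ≤ 5): pairField g L = √2 Σ_m σ_g(m) b_m exactly; hopping −Σ_{x∼y} c†c on
fermionTorusGraph ⇒ ε_k = −2(cos k₁ + cos k₂) for L ≥ 3.
NOVELTY and BARRIERS: full text in the route's Novelty / Barriers fields (nearest prior art
BachLiebSolovej1994 Thm 2.11, KuboKishi1990, Zhang1990, KomaTasakiPRL1992/SuSuzuki1998,
PitaevskiiStringari1991, Tian1992; delta = EOM of the pair mode closed against the neighbouring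
sectors ⇒ soft Pauli blocking for every GS ⇒ channel-uniform every-GS ceiling, assembled into 'no
U-uniform witness'; barriers GeneralizedHartreeFockNoPairing extended not met,
PerturbativeInvisibility not met (no truncation), WeakCouplingCeiling and LROForcesLowLyingStates
used, StrongCouplingCeiling not engaged).

Novelty: Searched this session (2026-08-15): `lit frontier HubbardSuperconductivity --since 2020` (30 rows;
nearest arXiv:2601.18868 'Cooper condensation and pair wave functions in strongly correlated
electrons' — Yang-criterion/pair-wavefunction study, and arXiv:2501.18141 mean-field AF gap; nothing
on every-ground-state pairing ceilings); crossref 'rigorous bound superconducting pairing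
correlations Hubbard model ground state' and 'upper bound off-diagonal long-range order Hubbard
model' (Yang1989 = doi:10.1103/physrevlett.63.2144; Tian1992 = doi:10.1103/physrevb.45.3145
[paywalled, acq-00695 cite-only]; Shen–Qiu 1993 doi:10.1103/physrevlett.71.4238; Litvinov–Tovstyuk
1977 doi:10.1002/pssb.2220790256; doi:10.1103/physrevb.53.5153 — existence / η-pairing / T>0
Bogoliubov-type statements, none a T = 0 ceiling small in U); crossref 'momentum distribution …
bound … lattice fermions ground state rigorous' (no rigorous hit); `lit search --hybrid` 'equation
of motion pair operator bound … neighbouring particle number sectors' (held textbooks only: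
book:essler2005-one-dimensional-hubbard-model, book:zagoskin2014-…, book:stefanucci2013-…,
book:griffin1995-bose-einstein-condensation); `lit galaxy search --star all` (substring, 4
phrasings: 0 theorem-shaped hits) and `--star pdf --mode intelligent` (8 hits:
Qin–Schäfer–Andergassen–Corboz–Gull computational review, cluster/DCA numerics, no rigorous bounds);
zbMATH (3 queries, 0 hits); OpenAlex/arXiv HTTP 429. Plus the card's two audited searche  [refs: 10.1103/physrevlett.63.2144, 10.1103/physrevb.45.3145, 10.1103/physrevlett.71.4238, 10.1002/pssb.2220790256, 10.1103/physrevb.53.5153, 10.1103/physrevb.41.4866, 10.1103/physrevb.42.1012, 2601.18868, 2501.18141, cond-mat/9312044, doi:10.1103/physrevlett.63.2144, doi:10.1103/physrevb.45.3145, doi:10.1103/physrevlett.71.4238, doi:10.1002/pssb.2220790256, doi:10.1103/physrevb.53.5153, book:essler2005-]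

Barriers (technique_class: equation-of-motion; sector-resolvent; operator-inequality): technique_class: equation-of-motion; sector-resolvent; operator-inequality (T = 0, finite L, no
expansion). Catalogue Literature/Barriers/HubbardSuperconductivity read (10 entries).
- Literature.Barriers.HubbardSuperconductivity.GeneralizedHartreeFockNoPairing: consistent with it
and EXTENDS it, not met — BLS Thm 2.11 says quasi-free states gain nothing from pairing against V ≥
0; EveryGSCeiling says TRUE sector ground states carry at most O(U²log⁴) pair order in any channel.
Nothing is inferred from quasi-free states, no gap equation is solved, so the barrier's restriction
to the variational class does not apply.
- Literature.Barriers.HubbardSuperconductivity.PerturbativeInvisibilityOfPairing and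
.PerturbativeInvisibilityOfPairingNarrow: not met — no power series in U is truncated; 'second
order' is an exact operator identity used once with the remainder BOUNDED IN NORM (‖[D,b_k]‖ ≤ 2),
valid at all U; the bound U²log⁴ sits far above the invisible scale e^{−1/(αρ²U²)} and claims
nothing below it. The barrier starts to bite exactly at crux BeyondSecondOrder (an all-orders
descent by EOM iteration meets non-sign-definite three-body denominators) — recorded as that crux's
why-might-fail.
- Literature.Barriers.HubbardSuperconductivity.WeakCouplingCeiling (Cooper logarithm, Salmhofer1999
§4.5.4): USED, not fought — the logarithm appears honestly as the (1+|log U|) factors of the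
Pauli-softened step Σ_k min(1, U/|ξ_k|) (plus the van Hove log); the route proves UPPER bounds, so
the

Novelty grade: new-combination — ROUTE REVIEW refuter b4055acd 2026-08-15 (record: evidence REVIEW_EomCeiling.md on stmt-2388; all 9 items stamped checked with briefing notes). NOVELTY new-combination (concur with card audit): Heisenberg EOM of the plane-wave pair mode (Zhang90 pseudospin/Gor'kov bookkeeping) + sector variational r (refuter refuter-rreview-route-Langlands-Eisenste-b4055acd-0, 2026-08-15T12:13:35Z; prior: BachLiebSolovej1994, Zhang1990, KuboKishi1990, KomaTasakiPRL1992, SuSuzuki1998, Tian1992, ArovasBergKivelsonRaghu2022)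

History (route lifecycle, newest last):
- 2026-08-15T13:48:18Z · CLOSED retired — not-a-thesis: assembly does not conclude the sub-problem Statement (operator:999:1257524)

sub-problem: HubbardSuperconductivity · status: closed(retired) · opened planner-plancard-HubbardSuperconductivity-Hub-86945429-0 2026-08-15T11:03:46Z · rev 1 · ledger route-HubbardSuperconductivity-EomCeiling
GENERATED by the gate from the ledger (D-0016/17). Provers cite these decls: `theorem foo : Summit.HubbardSuperconductivity.HubbardSuperconductivity.Theses.EomCeiling.<Decl> := …` in Summits/HubbardSuperconductivity/HubbardSuperconductivity/Theorems/<Name>.lean.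
-/

namespace Summit.HubbardSuperconductivity.HubbardSuperconductivity.Theses.EomCeiling

open scoped BigOperators Topology Manifold Classical MeasureTheory ProbabilityTheory Matrix InnerProductSpace ComplexConjugate ContinuousMap
open Filter Set Function TopologicalSpace MeasureTheory

attribute [summit_statement] _root_.HubbardSuperconductivity

open Literature.Hubbard

/-- item stmt-HubbardSuperconductivity-2388 · target · rank 0 · closed · moot by None · by planner
why it might fail: False only if at some δ every admissible GS sequence had d-wave pair order ≥ c uniformly as U→0⁺ — first-order pairing from repulsion, against BLS Thm 2.11 and T_c ~ e^{−1/(αρ²U²)} (Kohn–Luttinger); provable here only via EveryGSCeiling + WeakCouplingStability, whose κ_L is uncontrolled.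
sources: BachLiebSolovej1994, ArovasBergKivelsonRaghu2022, RaghuKivelsonScalapino2010, Scalapino1995, KohnLuttinger1965
[target] NO U-UNIFORM WITNESS OF THE SUMMIT (negative knowledge, calibration): it is NOT the case
that for some doping δ ∈ (0,1/2), constant c > 0 and U₀ > 0, for ALL U ∈ (0,U₀) every admissible
sequence (N, ψ) — exactly the Statement's hypotheses: N L = 2⌊(1−δ)L²/2⌋, ‖ψ_L‖ = 1,
IsGroundStateInSector (hubbardTorus 2 L 1 U) (N L) 0 (ψ L) for even L — has eventually (2k)⁻⁴ Σ_{x,y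
∈ halfOpenBox 2 (2k)} torusPullback (pairFieldCorr dWaveFormFactor ψ) (2k) x y ≥ c (the very
quantity whose liminf the summit asks to be positive). Equivalently: the d-wave order constant of
the Hubbard ground states, if any, must vanish as U → 0⁺ along some ground-state sequences;
quantitatively (EveryGSCeiling) every S-witness (U,δ,c) has c ≤ C_d U²(1+|log U|)⁴ up to finite-size
non-convexity. Proof plan = Assembly: EveryGSCeiling + WeakCouplingStability (pick U small with C
U²log⁴ < c/4 and κ_L < c/(4C) frequently; choose a sector GS at each even L; the ceiling makes the
LRO density < c infinitely often). Alternative engine: BeyondSecondOrder alone. card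
HubbardSuperconductivity/HubbardSuperconductivity/eom-resolvent-ceiling §Assembly sketch (a),(b). -/
@[route_item "route-HubbardSuperconductivity-EomCeiling"]
def NoUniformWeakCouplingOrder : Prop :=
  ¬ (∃ δ ∈ Set.Ioo (0 : ℝ) (1 / 2), ∃ c : ℝ, 0 < c ∧ ∃ U₀ : ℝ, 0 < U₀ ∧ ∀ U ∈ Set.Ioo (0 : ℝ) U₀, ∀ (N : ℕ → ℕ) (ψ : ∀ L, Literature.MathematicalPhysics.QuantumLattice.Fock (Literature.MathematicalPhysics.QuantumLattice.Orb (Literature.MathematicalPhysics.QuantumLattice.FermionTorus 2 L))), (∀ L, Even L → N L = 2 * ⌊(1 - δ) * (L : ℝ) ^ 2 / 2⌋₊ ∧ star (ψ L) ⬝ᵥ ψ L = 1 ∧ Literature.MathematicalPhysics.QuantumLattice.IsGroundStateInSector (Literature.MathematicalPhysics.QuantumLattice.hubbardTorus 2 L 1 U) (N L) 0 (ψ L)) → ∀ᶠ k : ℕ in Filter.atTop, c ≤ (∑ x ∈ Literature.Probability.LatticeModels.halfOpenBox 2 (2 * k), ∑ y ∈ Literature.Probability.LatticeModels.halfOpenBox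 2 (2 * k), Literature.MathematicalPhysics.QuantumLattice.torusPullback (Literature.MathematicalPhysics.QuantumLattice.pairFieldCorr Literature.MathematicalPhysics.QuantumLattice.dWaveFormFactor ψ) (2 * k) x y) / ((2 * k : ℕ) : ℝ) ^ 4)

/-- item stmt-HubbardSuperconductivity-2389 · crux · rank 2 · closed · moot by None · by planner
why it might fail: Unpublished inequality; as typed (∃C(g) only: log⁴, κ linear, 1/L) it is exactly as strong as three μ-uniform lattice counts through the van Hove level allow: #{|ε_m−μ|<a} ≤ C(L²a+L)(1+log⁺(1/(a+1/L))), (#W)² ≤ CL⁴(κ+1/L), (1+log L)²/L ≤ C; one worse log power or a lost factor L falsifies it.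
sources: BachLiebSolovej1994, Zhang1990, KomaTasaki1994, KuboKishi1990, Salmhofer1999, arXiv:1204.6470
[crux] EVERY-GROUND-STATE WEAK-COUPLING CEILING (BLS for true ground states; the mechanism's
theorem, provable now). For every form factor g : ℤ² → ℝ (only its values on {0, ±e₁, ±e₂} matter)
there is C such that for EVERY real U, every L ≥ 3, every N and every normalised (N, S^z=0)-sector
ground state ψ of H = hubbardTorus 2 L 1 U: L⁻⁴ Re⟨ψ, (pairField g L)†(pairField g L) ψ⟩ ≤
C·(U²(1+|log U|)⁴ + κ + 1/L), κ := max 0 (E(N) − (E(N−2)+E(N+2))/2), E(M) := H.minEnergyOn (szSector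
M 0) (ℕ-subtraction and empty-sector junk E = 0 only enlarge κ; odd N is vacuous). PROOF (card steps
(1)–(3), all finite-dimensional): write pairField g L = √2 Σ_m σ_g(m) b_m (PairFieldPlaneWaves),
split the modes at μ_L := (E(N)−E(N−2))/2: OUT = {ε_m > μ_L}, IN = {ε_m ≤ μ_L}; ‖Δ_out ψ‖ ≤ √2 Σ_OUT
|σ_g| ‖b_mψ‖ ≤ √2‖g‖₁ Σ_OUT min(1, |U|/(ε_m − μ_L)) (SoftPauliBlockingPairs); ‖Δ_in ψ‖² = ‖Δ_in†ψ‖²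
+ ⟨[Δ_in†, Δ_in]⟩ with [b_m†, b_{m'}] = δ_{mm'}(n_{m↑} + n_{−m↓} − 1) (distinct pair modes commute)
so the commutator term is ≤ 2‖g‖₁² L²; ‖Δ_in†ψ‖ ≤ √2 Σ_IN |σ_g| ‖b_m†ψ‖ with ‖b_m†ψ‖ ≤ min(1,
|U|/(μ_L⁺ − ε_m)) for ε_m < μ_L⁺ := (E(N+2)−E(N))/2 and the trivial bound 1 on the window W = {μ_L⁺
≤ ε_m ≤ μ_L} (width κ) — -/
@[route_item "route-HubbardSuperconductivity-EomCeiling"]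
def EveryGSCeiling : Prop :=
  ∀ g : Literature.Probability.LatticeModels.Site 2 → ℝ, ∃ C : ℝ, ∀ (U : ℝ) (L : ℕ) [NeZero L], 2 < L → ∀ (N : ℕ) (ψ : Literature.MathematicalPhysics.QuantumLattice.Fock (Literature.MathematicalPhysics.QuantumLattice.Orb (Literature.MathematicalPhysics.QuantumLattice.FermionTorus 2 L))), star ψ ⬝ᵥ ψ = 1 → Literature.MathematicalPhysics.QuantumLattice.IsGroundStateInSector (Literature.MathematicalPhysics.QuantumLattice.hubbardTorus 2 L 1 U) N 0 ψ → (let E : ℕ → ℝ := fun M => (Literature.MathematicalPhysics.QuantumLattice.hubbardTorus 2 L 1 U).minEnergyOn (Literature.MathematicalPhysics.QuantumLattice.szSector M 0); (Literature.MathematicalPhysics.QuantumLattice.expect (Matrix.conjTranspose (Literature.MathematicalPhysics.QuantumLattice.pairField g L) * Literature.MathematicalPhysics.QuantumLattice.pairField g L) ψ).re / (L : ℝ) ^ 4 ≤ C * (U ^ 2 * (1 + |Real.log U|) ^ 4 + max 0 (E N - (E (N - 2) + E (N + 2)) / 2) + 1 / (L : ℝ)))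

/-- item stmt-HubbardSuperconductivity-2390 · crux · rank 3 · closed · moot by None · by planner
why it might fail: Needs at ONE fixed U>0 o(1) control of E(N_L±2)−E(N_L) (total 2D sector energies) along infinitely many L; no T=0 method is O(1)-accurate (BGM06: T>0; PT: U≪1/L²); false if repulsion drives the even-step curvature at N_L below −2η for all large even L (cluster non-convexity: TsaiKivelson2006 eq.2).
sources: TsaiKivelson2006, BenfattoGiulianiMastropietro2006, LiebWu1968, ArovasBergKivelsonRaghu2022, Tasaki1998, IgoshevEtAl2010
[crux] FINITE-VOLUME STABILITY AT WEAK COUPLING (the Assembly's only non-EOM input; open). For every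
δ ∈ (0,1/2), η > 0 and U₀ > 0 there is U ∈ (0,U₀) such that for infinitely many EVEN L the sector
energies E(M) := (hubbardTorus 2 L 1 U).minEnergyOn (szSector M 0) are η-midpoint-convex at N = N_L
:= 2⌊(1−δ)L²/2⌋: E(N) − (E(N−2)+E(N+2))/2 < η, i.e. the pair-addition chemical potential does not
jump DOWN by more than 2η across N_L (κ_L = (μ_L − μ_L⁺)₊ < η). Facts: at U = 0 κ_L = 0 exactly for
even N (the S^z = 0 free gas fills doubly-degenerate levels in increasing order, so E⁰(N+2) − E⁰(N)
= 2λ_{N/2+1} ≥ 2λ_{N/2} = E⁰(N) − E⁰(N−2)); for fixed L, U ↦ E(M)(U) is continuous (finite Hermitian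
family), so κ_L(U) → 0 as U → 0 — but only pointwise in L, whereas the target needs ONE U serving
infinitely many L; cheap bounds give only κ_L ≤ U·N²/(4L²) = O(U L²) (variational with the free GS,
D ≥ 0) and κ_L ≤ 8 + O(U) (pair chemical potential window, cf.
EnslavedA1g.PairChemicalPotentialWindow). Physically κ_L = O(1/L²) at weak coupling (Fermi liquid;
thermodynamic e(ρ) convex and smooth, BenfattoGiulianiMastropietro2006 at T > 0). The weakest form
the Assembly consumes is filed; the natural -/
@[route_item "route-HubbardSuperconductivity-EomCeiling"]
def WeakCouplingStability : Prop :=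
  ∀ δ ∈ Set.Ioo (0 : ℝ) (1 / 2), ∀ η : ℝ, 0 < η → ∀ U₀ : ℝ, 0 < U₀ → ∃ U ∈ Set.Ioo (0 : ℝ) U₀, ∃ᶠ L : ℕ in Filter.atTop, Even L ∧ (let N : ℕ := 2 * ⌊(1 - δ) * (L : ℝ) ^ 2 / 2⌋₊; let E : ℕ → ℝ := fun M => (Literature.MathematicalPhysics.QuantumLattice.hubbardTorus 2 L 1 U).minEnergyOn (Literature.MathematicalPhysics.QuantumLattice.szSector M 0); E N - (E (N - 2) + E (N + 2)) / 2 < η)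

/-- item stmt-HubbardSuperconductivity-2391 · crux · rank 4 · closed · moot by None · by planner
why it might fail: Open mechanism: a 2nd EOM iteration on [D,b_k] meets 3-fermion symbols ε_{p'}+ε_{k+p−p'}+ε_k−ε_p not sign-definite against the sector gap, so the resolvent step fails (PerturbativeInvisibility bites); as typed (∃ᶠ slack, no κ_L) it absorbs finite-size stability; false iff a channel orders at ≳U².
sources: KohnLuttinger1965, RaghuKivelsonScalapino2010, ArovasBergKivelsonRaghu2022, Salmhofer1999, FeldmanKnorrerTrubowitz2004, Literature.Barriers.HubbardSuperconductivity.PerturbativeInvisibilityOfPairing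
[crux] BEYOND SECOND ORDER (the line's research bet; open; implies the target by itself). For every
form factor g there are C, U₀ > 0 such that for all U ∈ (0,U₀), all δ ∈ (0,1/2) and every admissible
sequence (N, ψ) (the Statement's hypotheses), FREQUENTLY along even sides 2k: (2k)⁻⁴ Σ_{x,y ∈
halfOpenBox 2 (2k)} torusPullback (pairFieldCorr g ψ) (2k) x y ≤ C·U⁴ — every-ground-state pair
order is at most FOURTH order in U (the natural conjecture is O(Uⁿ) for every n, i.e.
PerturbativeInvisibilityOfPairing from ABOVE for true ground states; physically LRO ~
e^{−2/(αρ²U²)}). 'Frequently' (∃ᶠ) is the form that both tolerates finite-size non-convexity along a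
subsequence and still negates the target's 'eventually ≥ c'. Candidate mechanisms: iterate the
equation of motion once on the dressed pair X_k = [D,b_k] = −F_k c_{−k↓} − c_{k↑}F'_{−k} (F_k =
L⁻²Σ_{p,p'} c†_{p↓}c_{p'↓}c_{k+p−p',↑}) and apply the resolvent step to its three-fermion components
where the symbol ε_{p'} + ε_{k+p−p'} + ε_k − ε_p exceeds 2μ_L, bounding the rest by phase space; or
the sourced-energy Legendre descent of card probe-legendre-order-ceiling one order down; or
Cauchy–Schwarz against Σ_k ‖X_kψ‖² = L⁻² Σ_r ‖A_rψ‖² -/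
@[route_item "route-HubbardSuperconductivity-EomCeiling"]
def BeyondSecondOrder : Prop :=
  ∀ g : Literature.Probability.LatticeModels.Site 2 → ℝ, ∃ C U₀ : ℝ, 0 < U₀ ∧ ∀ U ∈ Set.Ioo (0 : ℝ) U₀, ∀ δ ∈ Set.Ioo (0 : ℝ) (1 / 2), ∀ (N : ℕ → ℕ) (ψ : ∀ L, Literature.MathematicalPhysics.QuantumLattice.Fock (Literature.MathematicalPhysics.QuantumLattice.Orb (Literature.MathematicalPhysics.QuantumLattice.FermionTorus 2 L))), (∀ L, Even L → N L = 2 * ⌊(1 - δ) * (L : ℝ) ^ 2 / 2⌋₊ ∧ star (ψ L) ⬝ᵥ ψ L = 1 ∧ Literature.MathematicalPhysics.QuantumLattice.IsGroundStateInSector (Literature.MathematicalPhysics.QuantumLattice.hubbardTorus 2 L 1 U) (N L) 0 (ψ L)) → ∃ᶠ k : ℕ in Filter.atTop, (∑ x ∈ Literature.Probability.LatticeModels.halfOpenBox 2 (2 * k), ∑ y ∈ Literature.Probability.LatticeModels.halfOpenBox 2 (2 * k), Literature.MathematicalPhysics.QuantumLattice.torusPullback (Literature.MathematicalPhysics.QuantumLattice.pairFieldCorr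 g ψ) (2 * k) x y) / ((2 * k : ℕ) : ℝ) ^ 4 ≤ C * U ^ 4

/-- item stmt-HubbardSuperconductivity-2392 · support · rank 9 · closed · moot by None · by planner
sources: Zhang1990, Yang1989, Tasaki2020
[support] EXACT LATTICE GAP EQUATION, operator form (provable now; CAR algebra + Fourier analysis on
(ℤ/Lℤ)², L ≥ 3). With c_{m↑}-sum cu := Σ_x e^{−2πi m·x/L} c_{x↑}, cd := Σ_y e^{+2πi m·y/L} c_{y↓},
the pair mode b := L⁻²·cu·cd (= c_{m↑}c_{−m↓} for the unit-CAR plane waves c_{mσ} = L⁻¹Σ_x e^{−2πi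
m·x/L}c_{xσ}), ε := −2(cos(2πm₀/L) + cos(2πm₁/L)) and D := Σ_x n_{x↑}n_{x↓} (numberOp x 0 * numberOp
x 1): H b − b H = −2ε·b + U·(D b − b D) for H = hubbardTorus 2 L 1 U, every real U. Proof: H = T +
U·D with T = −Σ_σ Σ_x Σ_{y∼x} c†_{xσ}c_{yσ} (hamiltonian on fermionTorusGraph: ordered adjacent
pairs, t = 1); [c†_{xσ}c_{yσ}, c_{zτ}] = −δ_{(xσ),(zτ)} c_{yσ} gives [T, Σ_z f_z c_{z↑}] = −Σ_y
(hf)_y c_{y↑} with h = −(adjacency), and the plane wave f_z = e^{−2πi m·z/L} is an h-eigenvector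
with eigenvalue ε (needs L ≥ 3: for L = 2 the simple graph identifies x ± e₁ and the dispersion
halves; for L = 1 there are no edges); hence [T, cu] = −ε·cu, [T, cd] = −ε·cd, [T, b] = −2ε b, and
[U·D, b] is the remaining term verbatim. Applied to a sector eigenvector Hψ = Eψ this is the exact
Gor'kov equation (H − E + 2ε) bψ = U[D,b]ψ in sector N−2. Conventions verified numerically at
coefficient level (plann -/
@[route_item "route-HubbardSuperconductivity-EomCeiling"]
def PairModeEquationOfMotion : Prop :=
  ∀ (U : ℝ) (L : ℕ), 2 < L → ∀ m : Fin 2 → Fin L, (let b : Matrix (Finset (Literature.MathematicalPhysics.QuantumLattice.Orb (Literature.MathematicalPhysics.QuantumLattice.FermionTorus 2 L))) (Finset (Literature.MathematicalPhysics.QuantumLattice.Orb (Literature.MathematicalPhysics.QuantumLattice.FermionTorus 2 L))) ℂ := ((1 : ℂ) / (L : ℂ) ^ 2) • ((∑ x : Literature.MathematicalPhysics.QuantumLattice.FermionTorus 2 L, Complex.exp (-(2 * Real.pi * Complex.I * (∑ i : Fin 2, ((m i : ℕ) : ℂ) * ((ofLex x i : ℕ) : ℂ)) / (L : ℂ)))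 • Literature.MathematicalPhysics.QuantumLattice.annihilation (Literature.MathematicalPhysics.QuantumLattice.orb x 0)) * (∑ y : Literature.MathematicalPhysics.QuantumLattice.FermionTorus 2 L, Complex.exp (2 * Real.pi * Complex.I * (∑ i : Fin 2, ((m i : ℕ) : ℂ) * ((ofLex y i : ℕ) : ℂ)) / (L : ℂ)) • Literature.MathematicalPhysics.QuantumLattice.annihilation (Literature.MathematicalPhysics.QuantumLattice.orb y 1))); let ε : ℝ := -2 * (Real.cos (2 * Real.pi * ((m 0 : ℕ) : ℝ) / (L : ℝ)) + Real.cos (2 * Real.pi * ((m 1 : ℕ) : ℝ) / (L : ℝ))); let D : Matrix (Finset (Literature.MathematicalPhysics.QuantumLattice.Orb (Literature.MathematicalPhysics.QuantumLattice.FermionTorus 2 L))) (Finset (Literature.MathematicalPhysics.QuantumLattice.Orb (Literature.MathematicalPhysics.QuantumLattice.FermionTorus 2 L))) ℂ := ∑ x : Literature.MathematicalPhysics.QuantumLattice.FermionTorus 2 L, Literature.MathematicalPhysics.QuantumLattice.numberOp x 0 * Literature.MathematicalPhysics.QuantumLattice.numberOp x 1; Literature.MathematicalPhysics.QuantumLattice.hubbardTorus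 2 L 1 U * b - b * Literature.MathematicalPhysics.QuantumLattice.hubbardTorus 2 L 1 U = (-(2 * ε) : ℂ) • b + (U : ℂ) • (D * b - b * D))

/-- item stmt-HubbardSuperconductivity-2393 · support · rank 9 · closed · moot by None · by planner
sources: BachLiebSolovej1994, Zhang1990, KomaTasaki1994
[support] SOFT PAULI BLOCKING, pair version (provable now from PairModeEquationOfMotion + the sector
variational principle; the heart of the mechanism). For every real U, L ≥ 3, N, every normalised (N,
S^z=0)-sector ground state ψ of H = hubbardTorus 2 L 1 U and every mode m, with b, ε as in
PairModeEquationOfMotion, E(M) := H.minEnergyOn (szSector M 0), μ := (E(N) − E(N−2))/2, μ' :=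
(E(N+2) − E(N))/2: (i) μ < ε ⇒ ‖bψ‖² ≤ U²/(ε − μ)²; (ii) ε < μ' ⇒ ‖b†ψ‖² ≤ U²/(μ' − ε)². (Free gas:
bψ = 0 above the Fermi level exactly; interaction softens the step to a |U|/|ξ| tail — for EVERY
ground state at EVERY coupling.) Proof of (i): φ := bψ lies in szSector (N−2) 0 (b removes one ↑ and
one ↓; for N < 2, φ = 0); by the EOM (H − E(N) + 2ε)φ = U[D,b]ψ; the variational principle on the
sector gives Re⟨φ,Hφ⟩ ≥ E(N−2)‖φ‖² (sInf over normalised sector vectors, bounded below in finite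
dimension), so 2(ε − μ)‖φ‖² ≤ Re⟨φ, U[D,b]ψ⟩ ≤ |U|·‖φ‖·‖[D,b]ψ‖ ≤ 2|U|‖φ‖, using ‖[D,b]‖ ≤ 2: [D,
c_{x↑}] = −n_{x↓}c_{x↑} ⇒ [D, L⁻¹cu] = −F with F = L⁻¹Σ_x e^{−2πi m·x/L} n_{x↓}c_{x↑}, {F, F†} =
N_↓/L² ≤ 1 ⇒ ‖F‖ ≤ 1 (‖X‖² ≤ ‖X†X + XX†‖), similarly for cd, and [D,b] = −F·(L⁻¹cd) − (L⁻¹cu)·F'.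
(ii) is the adjoint stateme -/
@[route_item "route-HubbardSuperconductivity-EomCeiling"]
def SoftPauliBlockingPairs : Prop :=
  ∀ (U : ℝ) (L : ℕ), 2 < L → ∀ (N : ℕ) (ψ : Literature.MathematicalPhysics.QuantumLattice.Fock (Literature.MathematicalPhysics.QuantumLattice.Orb (Literature.MathematicalPhysics.QuantumLattice.FermionTorus 2 L))), star ψ ⬝ᵥ ψ = 1 → Literature.MathematicalPhysics.QuantumLattice.IsGroundStateInSector (Literature.MathematicalPhysics.QuantumLattice.hubbardTorus 2 L 1 U) N 0 ψ → ∀ m : Fin 2 → Fin L, (let b : Matrix (Finset (Literature.MathematicalPhysics.QuantumLattice.Orb (Literature.MathematicalPhysics.QuantumLattice.FermionTorus 2 L))) (Finset (Literature.MathematicalPhysics.QuantumLattice.Orb (Literature.MathematicalPhysics.QuantumLattice.FermionTorus 2 L))) ℂ := ((1 : ℂ) / (L : ℂ) ^ 2) • ((∑ x : Literature.MathematicalPhysics.QuantumLattice.FermionTorus 2 L, Complex.exp (-(2 * Real.pi * Complex.I * (∑ i : Fin 2, ((m i : ℕ) : ℂ) * ((ofLex x i : ℕ) : ℂ)) / (L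 : ℂ))) • Literature.MathematicalPhysics.QuantumLattice.annihilation (Literature.MathematicalPhysics.QuantumLattice.orb x 0)) * (∑ y : Literature.MathematicalPhysics.QuantumLattice.FermionTorus 2 L, Complex.exp (2 * Real.pi * Complex.I * (∑ i : Fin 2, ((m i : ℕ) : ℂ) * ((ofLex y i : ℕ) : ℂ)) / (L : ℂ)) • Literature.MathematicalPhysics.QuantumLattice.annihilation (Literature.MathematicalPhysics.QuantumLattice.orb y 1))); let ε : ℝ := -2 * (Real.cos (2 * Real.pi * ((m 0 : ℕ) : ℝ) / (L : ℝ)) + Real.cos (2 * Real.pi * ((m 1 : ℕ) : ℝ) / (L : ℝ))); let E : ℕ → ℝ := fun M => (Literature.MathematicalPhysics.QuantumLattice.hubbardTorus 2 L 1 U).minEnergyOn (Literature.MathematicalPhysics.QuantumLattice.szSector M 0); let μ : ℝ := (E N - E (N - 2)) / 2; let μ' : ℝ := (E (N + 2) - E N) / 2; (μ < ε → (star (b *ᵥ ψ) ⬝ᵥ (b *ᵥ ψ)).re ≤ U ^ 2 / (ε - μ) ^ 2) ∧ (ε < μ' → (star (Matrix.conjTranspose b *ᵥ ψ) ⬝ᵥ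 (Matrix.conjTranspose b *ᵥ ψ)).re ≤ U ^ 2 / (μ' - ε) ^ 2))

/-- item stmt-HubbardSuperconductivity-2394 · support · rank 9 · closed · moot by None · by planner
sources: Scalapino1995, Tasaki2020
[support] PLANE-WAVE (PARSEVAL) EXPANSION OF THE TREE'S PAIR FIELD (provable now; every L ≥ 1, every
g : Site 2 → ℝ, no symmetry of g assumed): pairField g L = √2 · Σ_{m : Fin 2 → Fin L} σ_g(m) · b_m
with σ_g(m) := Σ_{e ∈ insert 0 unitSteps} g(e) cos(2π m·e/L) (real) and b_m := L⁻²(Σ_x e^{−2πi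
m·x/L} c_{x↑})(Σ_y e^{+2πi m·y/L} c_{y↓}), coordinates x_i = (ofLex x i : ℕ). Proof: localPair g L x
= Σ_e (g e/√2)(c_{x↑}c_{x+e,↓} − c_{x↓}c_{x+e,↑}); by the CAR (annihilation_anticommute_holds)
−c_{x↓}c_{x+e,↑} = c_{x+e,↑}c_{x,↓}, and re-indexing x' = x + e turns the second family into Σ_x
c_{x↑}c_{x−e,↓}; discrete Fourier inversion Σ_x c_{x↑}c_{x+f,↓} = Σ_m e^{−2πi m·f/L} b_m (from Σ_x
e^{2πi(m+m')·x/L} = L²δ) gives Σ_e (g e/√2)(e^{−ik·e} + e^{+ik·e}) = √2 Σ_e g(e)cos(k·e). For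
dWaveFormFactor σ_d(m) = 2(cos(2πm₀/L) − cos(2πm₁/L)), for sWave σ = 1, for extendedSWave σ = 2(cos
+ cos); |σ_g| ≤ Σ_e|g e|. Identity verified numerically at the coefficient-matrix level for L = 1..5
and g ∈ {d, s, s*, asymmetric} (planner's check_conv.py). This is the (K1) momentum-space bridge
shared with cards probe-legendre-order-ceiling, kac-window-penalty-sandwich, yrast-landau-ir-step.
card HubbardSupercondu -/
@[route_item "route-HubbardSuperconductivity-EomCeiling"]
def PairFieldPlaneWaves : Prop :=
  ∀ (g : Literature.Probability.LatticeModels.Site 2 → ℝ) (L : ℕ) [NeZero L], Literature.MathematicalPhysics.QuantumLattice.pairField g L = ((Real.sqrt 2 : ℝ) : ℂ) • ∑ m : Fin 2 → Fin L, ((∑ e ∈ insert (0 : Literature.Probability.LatticeModels.Site 2) Literature.MathematicalPhysics.QuantumLattice.unitSteps, g e * Real.cos (2 * Real.pi * (∑ i : Fin 2, ((m i : ℕ) : ℝ) * ((e i : ℤ) : ℝ)) / (L : ℝ)) : ℝ) : ℂ) • (((1 : ℂ) / (L : ℂ) ^ 2) • ((∑ x : Literature.MathematicalPhysics.QuantumLattice.FermionTorus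 2 L, Complex.exp (-(2 * Real.pi * Complex.I * (∑ i : Fin 2, ((m i : ℕ) : ℂ) * ((ofLex x i : ℕ) : ℂ)) / (L : ℂ))) • Literature.MathematicalPhysics.QuantumLattice.annihilation (Literature.MathematicalPhysics.QuantumLattice.orb x 0)) * (∑ y : Literature.MathematicalPhysics.QuantumLattice.FermionTorus 2 L, Complex.exp (2 * Real.pi * Complex.I * (∑ i : Fin 2, ((m i : ℕ) : ℂ) * ((ofLex y i : ℕ) : ℂ)) / (L : ℂ)) • Literature.MathematicalPhysics.QuantumLattice.annihilation (Literature.MathematicalPhysics.QuantumLattice.orb y 1))))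

/-- item stmt-HubbardSuperconductivity-2395 · support · rank 9 · closed · moot by None · by planner
sources: Salmhofer1999, FeldmanKnorrerTrubowitz2004
[support] μ-UNIFORM RESOLVENT SUM OVER THE BRILLOUIN ZONE (provable now; real analysis, the only
place the band structure enters). There is C such that for all L ≥ 3, all μ ∈ ℝ and 0 < U ≤ 1: Σ_{m
: Fin 2 → Fin L} min(1, U/|ε_m − μ|) ≤ C·(L²U(1+|log U|)² + L(1+log L)), ε_m =
−2(cos(2πm₀/L)+cos(2πm₁/L)) (typed with `if |ε_m − μ| ≤ U then 1 else U/|ε_m − μ|` to avoid the x/0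
= 0 junk). Proof sketch: layer cake Σ_m min(1,U/|ξ_m|) = ∫₀¹ N_L(μ, U/s) ds with the lattice
sublevel count N_L(μ,a) := #{m : |ε_m − μ| < a} ≤ (L/2π)²·|{k ∈ [−π,π]² : |ε(k) − μ| < a + c₀/L}|
(each lattice point owns a cell of diameter 2π√2/L and |∇ε| ≤ 2√2) and the UNIFORM continuum
estimate |{|ε − μ| < b}| ≤ C b(1 + log⁺(1/b)) (the free density of states is bounded except for the
logarithmic van Hove singularity ν(ε) ≈ (2π²)⁻¹log(16/|ε|) at ε = 0; elementary proof: for fixed k₁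
the k₂-measure of {|2cos k₂ + c| < b} is ≤ C min(√b, b/√(1 − c²/4)₊) and one integrates over k₁),
giving N_L(μ,a) ≤ C(L²a + L)(1 + |log(a + 1/L)|) — sharp: Θ(L log L) lattice points lie within 1/L
of the square |k₁|+|k₂| = π. Integrating: ≤ C[L + L²U + L²U(log(1/U) + ½log²(1/U)) + L(1 + log L)].
Used twice in EveryGSCeiling (at μ_L and μ_ -/
@[route_item "route-HubbardSuperconductivity-EomCeiling"]
def ResolventSumBound : Prop :=
  ∃ C : ℝ, ∀ L : ℕ, 2 < L → ∀ (μ U : ℝ), 0 < U → U ≤ 1 → (∑ m : Fin 2 → Fin L, (if |-2 * (Real.cos (2 * Real.pi * ((m 0 : ℕ) : ℝ) / (L : ℝ)) + Real.cos (2 * Real.pi * ((m 1 : ℕ) : ℝ) / (L : ℝ))) - μ| ≤ U then (1 : ℝ) else U / |-2 * (Real.cos (2 * Real.pi * ((m 0 : ℕ) : ℝ) / (L : ℝ)) + Real.cos (2 * Real.pi * ((m 1 : ℕ) : ℝ) / (L : ℝ))) - μ|)) ≤ C * ((L : ℝ) ^ 2 * U * (1 + |Real.log U|) ^ 2 + (L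 : ℝ) * (1 + Real.log (L : ℝ)))

/-- item stmt-HubbardSuperconductivity-2396 · assembly · rank 1 · closed · moot by None · by planner
sources: Scalapino1995, BachLiebSolovej1994
[assembly] EveryGSCeiling → WeakCouplingStability → NoUniformWeakCouplingOrder (bookkeeping +
existence of sector ground states; provable once the two antecedents are hypotheses). Proof: assume
the uniform-witness data (δ, c, U₀) of the negated target. Let C = C(dWaveFormFactor) from
EveryGSCeiling; choose u ≤ min(U₀, 1) with C·u²(1+|log u|)⁴ < c/4 on (0,u) (the function → 0 as U →
0⁺); apply WeakCouplingStability with η := c/(4C) and U₀ := u to get U ∈ (0,u) and infinitely many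
even L with κ_L(U) < η. Build an admissible sequence: for even L ≥ 4 pick ψ_L a normalised ground
state of hubbardTorus 2 L 1 U in szSector N_L 0 (exists: N_L = 2⌊(1−δ)L²/2⌋ ≤ L² is even, the sector
is a nonzero finite-dimensional subspace invariant under the Hermitian H — hubbardTorus_isHermitian,
commutation with totalNumber and spinZ (hamiltonian_isHermitian_and_commute_holds) — so minEnergyOn
is attained by an eigenvector: IsGroundStateInSector); for L = 2 likewise or directly; for odd L
take anything (the hypothesis only constrains even L). For this sequence and the infinitely many
good even L = 2k ≥ L₁ (with C/L < c/4): (2k)⁻⁴ Σ_{x,y ∈ halfOpenBox} torusPullback (pairFieldCorr d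
ψ)(2k) x y = (2k)⁻⁴ Re -/
@[route_item "route-HubbardSuperconductivity-EomCeiling"]
def Assembly : Prop :=
  EveryGSCeiling → WeakCouplingStability → NoUniformWeakCouplingOrder

end Summit.HubbardSuperconductivity.HubbardSuperconductivity.Theses.EomCeiling
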